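import Summits.QuantumFields.YangMills.Theorems.UnitScaleTiltProp8FlatCubeSequence
import HarnessLib

/-!
# Route `UnitScaleTilt`, crux K1 child «MinimiserStabilityRegPr» (stmt-QuantumFields-19200), v8 pillar P2/P5 — PILLAR F3′ FILE 5: **THE CUBE SEQUENCE (144)
# WITH BIG-BLOCK ALIGNMENT** ([Balaban1984PropagatorsII] (2.1) «Ω_j^{(j)} … is a sum of big blocks», [Balaban1985RegularSpaces] (1.4) «Ω_j is a sum of cubes of a
# size M₁Lʲη») — the `M`-block SATURATION of file 1's centred cubes: `cubeFinM`, `cubeSeqM : Domains P`, `cubeSetM`, with (2.1) PROVED (`cubeFinM_bigBlocks`),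
# nesting, and the (2.2)-type separation `dist_j(B⁻¹Ω_{j+1}, Ω_jᶜ) > S` at every level (`sep22_cubeSeqM`) — so that the instance fed to P2's `Adm22 D R M`
# (`FlatCubeOpsText`, p532698) satisfies BOTH clauses for `S ≥ R·M`

Cell `ym3-torus` (HUMAN RULING D-0037, YM ladder rung R3), seat `ym3-torus-p1` gen 15.  `--supports stmt-QuantumFields-19200 --as helper`; count-neutral.
Definitions `radM`, `cubeFinM`, `cubeSeqM`, `cubeSetM`, `cubeSeqMT3` + geometry; no analysis.  `M = 1` is (extensionally) file 1's `cubeSeq` with `S ↦ S`.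

TYPED READING.  `M`-blocks of `T^{(j)}`: the label `⌊y_μ/M⌋` coordinatewise (`(y μ).val / M`, the letter of `FlatCubeOpsText.Adm22`; no divisibility of the torus
side by `M` is needed — the clause and the construction use the same labels).  `cubeFinM x₀ k ρ S M j` := the `M`-SATURATION of the ball `{dist_j(y, c_j) ≤ radM (k−j)}`
(`y` belongs iff some `y₀` with the same `M`-labels lies in the ball); radii `radM 0 = ρ`, `radM (i+1) = L·radM i + (L·M − 1) + (L − 1)·0 + S'` with `S' = S`
… precisely `radM L M ρ S (i+1) = L * radM i + (L * M - 1) + S` (the saturation costs `M − 1` at the coarser level, i.e. `L(M−1)` one level down, absorbed).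

WHAT IS PROVED (sorry-free; axioms standard): `natAbs_valMinAbs_sub_le_of_div_eq` (same `M`-labels ⇒ coordinate circular distance `≤ M − 1`),
`distSite_le_of_sameBlockM`, `mem_cubeFinM_iff`, `ball_subset_cubeFinM`, **`cubeFinM_bigBlocks`** ((2.1)), `blockOf_mem_cubeFinM` (nesting), `cubeSeqM` (the
`Domains` structure), `cubeSeqM_Om_pos/zero`, **`sep22_cubeSeqM`** (for `j + 1 ≤ k`: `blockOf y ∈ Om (j+1)`, `y′ ∉ Om j` ⇒ `S + 1 ≤ dist_j(y, y′)`), `cubeSetM` +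
`inOm_cubeSeqM_iff`, `cubeSeqMT3`.  HONEST SCOPE: geometry; NOT a claim about the mass gap.

References: [Balaban1985Variational] (144) p.300; [Balaban1984PropagatorsII] (2.1)–(2.2) p.224; [Balaban1985RegularSpaces] (1.3)–(1.4) p.77.
-/

set_option autoImplicit false

noncomputable section

namespace Summit.QuantumFields.YangMills.Theorems.FlatCubeSequenceAligned

open Literature.MathematicalPhysics.QuantumFieldTheory.Balaban1983to89
open B5Eq117TorusCarriers (Mk)
open B5Eq118OneStroke (iterBlockOf iterBlockOf_succ iterBlockOf_zero)
open B5Prop12FieldsLattice (distSite distSite_self distSite_nonneg)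
open B5RowSumsP12Lattice (distSite_comm distSite_triangle)
open B6SectADomainsV1 (Domains)
open FlatCubeSequence (distSite_le_blockOf iterBlockOf_succ')

variable {P : Params} {j : ℕ}

/-! ## §1 Radii and the `M`-block distance lemma -/

/-- radii of the aligned cube sequence (inner cube `ρ`, separation `S`, big blocks `M`): `radM 0 = ρ`, `radM (i+1) = L·radM i + (L·M − 1) + S`.
[cite: Balaban1985Variational, (144) p.300] -/
def radM (L M ρ S : ℕ) : ℕ → ℕ
  | 0 => ρ
  | i + 1 => L * radM L M ρ S i + (L * M - 1) + S

/-- unfolding. [cite: Balaban1985Variational, (144) p.300] -/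
theorem radM_succ (L M ρ S i : ℕ) : radM L M ρ S (i + 1) = L * radM L M ρ S i + (L * M - 1) + S := rfl

/-- **SAME `M`-LABELS ⇒ CIRCULAR DISTANCE `≤ M − 1`** coordinatewise (for `1 ≤ M`). [folklore] -/
theorem natAbs_valMinAbs_sub_le_of_div_eq {N M : ℕ} [NeZero N] (hM : 1 ≤ M) (a b : ZMod N) (h : a.val / M = b.val / M) :
    ((a - b).valMinAbs).natAbs ≤ M - 1 := by
  have hz : (((a.val : ℤ) - (b.val : ℤ) : ℤ) : ZMod N) = a - b := by
    push_cast
    rw [ZMod.natCast_zmod_val, ZMod.natCast_zmod_val]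
  have he : (((a - b).valMinAbs : ℤ) : ZMod N) = (((a.val : ℤ) - (b.val : ℤ) : ℤ) : ZMod N) := by
    rw [ZMod.coe_valMinAbs, hz]
  have hmin := ZMod.natAbs_min_of_le_div_two N _ _ he (ZMod.natAbs_valMinAbs_le _)
  have hMpos : 0 < M := hM
  have ha := Nat.div_add_mod a.val M
  have hb := Nat.div_add_mod b.val M
  have hra : a.val % M < M := Nat.mod_lt _ hMpos
  have hrb : b.val % M < M := Nat.mod_lt _ hMpos
  have hbound : ((a.val : ℤ) - (b.val : ℤ)).natAbs ≤ M - 1 := by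
    rw [h] at ha
    omega
  exact hmin.trans hbound

/-- same `M`-labels in every coordinate ⇒ `distSite ≤ M − 1`. [folklore] -/
theorem distSite_le_of_sameBlockM {M : ℕ} (hM : 1 ≤ M) (y y' : Site P j) (h : ∀ μ, (y μ).val / M = (y' μ).val / M) :
    distSite (Mk P j) y y' ≤ ((M : ℝ) - 1) := by
  unfold distSite
  have key : (Finset.univ.sup fun μ : Fin P.d => ((y μ - y' μ).valMinAbs).natAbs) ≤ M - 1 :=
    Finset.sup_le fun μ _ => natAbs_valMinAbs_sub_le_of_div_eq hM (y μ) (y' μ) (h μ)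
  have hcast := (Nat.cast_le (α := ℝ)).2 key
  have hsub : ((M - 1 : ℕ) : ℝ) = (M : ℝ) - 1 := by rw [Nat.cast_sub hM, Nat.cast_one]
  simpa [hsub] using hcast

/-! ## §2 The aligned cubes -/

/-- **`□_j^{(j)}`, BIG-BLOCK ALIGNED**: the `M`-saturation of the ball of radius `radM (k − j)` about `c_j = iterBlockOf j x₀` — a `j`-block belongs iff some block with
the same `M`-labels lies in the ball. [cite: Balaban1984PropagatorsII, (2.1) p.224; Balaban1985Variational, (144) p.300] -/
def cubeFinM (x₀ : Site P 0) (k ρ S M : ℕ) (j : ℕ) : Finset (Site P j) :=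
  Finset.univ.filter fun y => ∃ y₀ : Site P j, (∀ μ, (y₀ μ).val / M = (y μ).val / M) ∧
    distSite (Mk P j) y₀ (iterBlockOf j x₀) ≤ (radM P.L M ρ S (k - j) : ℝ)

/-- membership. [cite: Balaban1985Variational, (144) p.300] -/
theorem mem_cubeFinM_iff (x₀ : Site P 0) (k ρ S M j : ℕ) (y : Site P j) :
    y ∈ cubeFinM x₀ k ρ S M j ↔ ∃ y₀ : Site P j, (∀ μ, (y₀ μ).val / M = (y μ).val / M) ∧
      distSite (Mk P j) y₀ (iterBlockOf j x₀) ≤ (radM P.L M ρ S (k - j) : ℝ) := by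
  simp [cubeFinM]

/-- the ball is inside its saturation. [cite: Balaban1985Variational, (144) p.300] -/
theorem mem_cubeFinM_of_dist (x₀ : Site P 0) (k ρ S M j : ℕ) {y : Site P j}
    (hy : distSite (Mk P j) y (iterBlockOf j x₀) ≤ (radM P.L M ρ S (k - j) : ℝ)) : y ∈ cubeFinM x₀ k ρ S M j :=
  (mem_cubeFinM_iff x₀ k ρ S M j y).2 ⟨y, fun _ => rfl, hy⟩

/-- **(2.1) «a sum of big blocks»**: membership in the aligned cube depends only on the `M`-labels. [cite: Balaban1984PropagatorsII, (2.1) p.224] -/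
theorem cubeFinM_bigBlocks (x₀ : Site P 0) (k ρ S M j : ℕ) (y y' : Site P j) (h : ∀ μ, (y μ).val / M = (y' μ).val / M) :
    (y ∈ cubeFinM x₀ k ρ S M j ↔ y' ∈ cubeFinM x₀ k ρ S M j) := by
  rw [mem_cubeFinM_iff, mem_cubeFinM_iff]
  constructor
  · rintro ⟨y₀, hy₀, hd⟩
    exact ⟨y₀, fun μ => (hy₀ μ).trans (h μ), hd⟩
  · rintro ⟨y₀, hy₀, hd⟩
    exact ⟨y₀, fun μ => (hy₀ μ).trans (h μ).symm, hd⟩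

/-- every member of the aligned cube is within `radM (k−j) + (M − 1)` of the centre. [cite: Balaban1985Variational, (144) p.300] -/
theorem dist_le_of_mem_cubeFinM {x₀ : Site P 0} {k ρ S M j : ℕ} (hM : 1 ≤ M) {y : Site P j} (hy : y ∈ cubeFinM x₀ k ρ S M j) :
    distSite (Mk P j) y (iterBlockOf j x₀) ≤ (radM P.L M ρ S (k - j) : ℝ) + ((M : ℝ) - 1) := by
  obtain ⟨y₀, hy₀, hd⟩ := (mem_cubeFinM_iff x₀ k ρ S M j y).1 hy
  have h1 := distSite_le_of_sameBlockM hM y y₀ (fun μ => (hy₀ μ).symm)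
  have htri := distSite_triangle (Mk P j) y y₀ (iterBlockOf j x₀)
  linarith

/-- **NESTING, ONE LEVEL** (`j + 1 ≤ k ≤ m + K`, `1 ≤ M`): if the `(j+1)`-block of `y` lies in the aligned `□_{j+1}^{(j+1)}` then `y` lies in (the ball of) `□_j^{(j)}`.
[cite: Balaban1985Variational, (144) p.300; Balaban1984PropagatorsII, (2.1) p.224] -/
theorem blockOf_mem_cubeFinM {x₀ : Site P 0} {k ρ S M : ℕ} (hM : 1 ≤ M) (hk : k ≤ P.m + P.K) {j : ℕ} (hjk : j + 1 ≤ k) {y : Site P j}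
    (hy : blockOf y ∈ cubeFinM x₀ k ρ S M (j + 1)) :
    distSite (Mk P j) y (iterBlockOf j x₀) ≤ (radM P.L M ρ S (k - j) : ℝ) := by
  have hj : j + 1 ≤ P.m + P.K := hjk.trans hk
  have hkj : k - j = (k - (j + 1)) + 1 := by omega
  have hL0 : (0 : ℝ) ≤ P.L := Nat.cast_nonneg _
  have hd := dist_le_of_mem_cubeFinM (x₀ := x₀) (k := k) (ρ := ρ) (S := S) hM hy
  calc distSite (Mk P j) y (iterBlockOf j x₀)
      ≤ (P.L : ℝ) * distSite (Mk P (j + 1)) (blockOf y) (blockOf (iterBlockOf j x₀)) + ((P.L : ℝ) - 1) :=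
        distSite_le_blockOf hj y (iterBlockOf j x₀)
    _ ≤ (P.L : ℝ) * ((radM P.L M ρ S (k - (j + 1)) : ℝ) + ((M : ℝ) - 1)) + ((P.L : ℝ) - 1) := by
        rw [← iterBlockOf_succ']
        have := mul_le_mul_of_nonneg_left hd hL0
        linarith
    _ ≤ (radM P.L M ρ S (k - j) : ℝ) := by
        rw [hkj, radM_succ]
        have hLM : 1 ≤ P.L * M := Nat.one_le_iff_ne_zero.mpr (Nat.mul_ne_zero P.L_pos.ne' (by omega))
        have hsub : ((P.L * M - 1 : ℕ) : ℝ) = (P.L : ℝ) * M - 1 := by rw [Nat.cast_sub hLM, Nat.cast_mul, Nat.cast_one]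
        push_cast
        rw [hsub]
        nlinarith [(Nat.cast_nonneg S : (0 : ℝ) ≤ S), hL0]

/-- **THE ALIGNED CUBE SEQUENCE AS A NESTED FAMILY** (`1 ≤ M`): `Om 0 = T`, `Om j = cubeFinM … j` for `1 ≤ j ≤ k`, `∅` beyond.
[cite: Balaban1985Variational, (144) p.300; Balaban1984PropagatorsII, (2.1)-(2.4) p.224] -/
def cubeSeqM (x₀ : Site P 0) (k : ℕ) (hk : k ≤ P.m + P.K) (ρ S M : ℕ) (hM : 1 ≤ M) : Domains P where
  k := k
  hk := hk
  Om j := if j = 0 then Finset.univ else if j ≤ k then cubeFinM x₀ k ρ S M j else ∅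
  Om_zero := by simp
  Om_eq_empty j hj := by
    have h0 : j ≠ 0 := by omega
    simp [h0, not_le.mpr hj]
  nested j y hy := by
    by_cases hjk : j + 1 ≤ k
    · have hy' : blockOf y ∈ cubeFinM x₀ k ρ S M (j + 1) := by simpa [hjk] using hy
      by_cases hj0 : j = 0
      · simp [hj0]
      · have hjle : j ≤ k := by omega
        simpa [hj0, hjle] using mem_cubeFinM_of_dist x₀ k ρ S M j (blockOf_mem_cubeFinM hM hk hjk hy')
    · exfalso
      simp [hjk] at hy

/-- top level. [cite: Balaban1985Variational, (144) p.300] -/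
@[simp] theorem cubeSeqM_k (x₀ : Site P 0) (k : ℕ) (hk : k ≤ P.m + P.K) (ρ S M : ℕ) (hM : 1 ≤ M) : (cubeSeqM x₀ k hk ρ S M hM).k = k := rfl

/-- the positive levels are the aligned cubes. [cite: Balaban1985Variational, (144) p.300] -/
theorem cubeSeqM_Om_pos (x₀ : Site P 0) {k : ℕ} (hk : k ≤ P.m + P.K) (ρ S M : ℕ) (hM : 1 ≤ M) {j : ℕ} (hj : 1 ≤ j) (hjk : j ≤ k) :
    (cubeSeqM x₀ k hk ρ S M hM).Om j = cubeFinM x₀ k ρ S M j := by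
  have h0 : j ≠ 0 := by omega
  simp [cubeSeqM, h0, hjk]

/-- level `0` is the whole torus (`Λ₀ = T ∖ □₁` frozen). [cite: Balaban1984PropagatorsII, (2.3)-(2.4) p.224] -/
theorem cubeSeqM_Om_zero (x₀ : Site P 0) {k : ℕ} (hk : k ≤ P.m + P.K) (ρ S M : ℕ) (hM : 1 ≤ M) : (cubeSeqM x₀ k hk ρ S M hM).Om 0 = Finset.univ := rfl

/-- **(2.1) FOR `cubeSeqM`**: at every positive level membership depends only on the `M`-labels. [cite: Balaban1984PropagatorsII, (2.1) p.224] -/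
theorem cubeSeqM_bigBlocks (x₀ : Site P 0) {k : ℕ} (hk : k ≤ P.m + P.K) (ρ S M : ℕ) (hM : 1 ≤ M) :
    ∀ j, 1 ≤ j → ∀ y y' : Site P j, (∀ μ, (y μ).val / M = (y' μ).val / M) →
      (y ∈ (cubeSeqM x₀ k hk ρ S M hM).Om j ↔ y' ∈ (cubeSeqM x₀ k hk ρ S M hM).Om j) := by
  intro j hj y y' h
  by_cases hjk : j ≤ k
  · rw [cubeSeqM_Om_pos x₀ hk ρ S M hM hj hjk]
    exact cubeFinM_bigBlocks x₀ k ρ S M j y y' h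
  · have : (cubeSeqM x₀ k hk ρ S M hM).Om j = ∅ := (cubeSeqM x₀ k hk ρ S M hM).Om_eq_empty (by simp; omega)
    simp [this]

/-- **(2.2) FOR `cubeSeqM`**: a `j`-block whose `(j+1)`-block lies in `Ω_{j+1}` and a `j`-block outside `Ω_j` are `≥ S + 1` apart (`1 ≤ M`; all levels; for
`j ≥ k` the hypothesis is void). [cite: Balaban1984PropagatorsII, (2.2) p.224; Balaban1985Variational, (144) p.300] -/
theorem sep22_cubeSeqM (x₀ : Site P 0) {k : ℕ} (hk : k ≤ P.m + P.K) (ρ S M : ℕ) (hM : 1 ≤ M) :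
    ∀ j, ∀ y y' : Site P j, blockOf y ∈ (cubeSeqM x₀ k hk ρ S M hM).Om (j + 1) → y' ∉ (cubeSeqM x₀ k hk ρ S M hM).Om j →
      (S : ℝ) + 1 ≤ distSite (Mk P j) y y' := by
  intro j y y' hy hy'
  by_cases hjk : j + 1 ≤ k
  · have hj : j + 1 ≤ P.m + P.K := hjk.trans hk
    rw [cubeSeqM_Om_pos x₀ hk ρ S M hM (by omega) hjk] at hy
    have hkj : k - j = (k - (j + 1)) + 1 := by omega
    have hL0 : (0 : ℝ) ≤ P.L := Nat.cast_nonneg _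
    -- `y` is within `L·(radM(k−j−1) + M − 1) + (L − 1)` of `c_j`
    have h1 : distSite (Mk P j) y (iterBlockOf j x₀) ≤ (P.L : ℝ) * ((radM P.L M ρ S (k - (j + 1)) : ℝ) + ((M : ℝ) - 1)) + ((P.L : ℝ) - 1) := by
      have hd := dist_le_of_mem_cubeFinM (x₀ := x₀) (k := k) (ρ := ρ) (S := S) hM hy
      have := distSite_le_blockOf hj y (iterBlockOf j x₀)
      rw [← iterBlockOf_succ'] at this
      have h2 := mul_le_mul_of_nonneg_left hd hL0
      linarith
    -- `y′` is outside the ball of radius `radM (k−j)` (it is outside the saturation, a fortiori outside the ball; at `j = 0`, `Om 0 = T` makes `hy'` absurd)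
    have h3 : (radM P.L M ρ S (k - j) : ℝ) < distSite (Mk P j) y' (iterBlockOf j x₀) := by
      by_contra hle
      rw [not_lt] at hle
      by_cases hj0 : j = 0
      · subst hj0; exact hy' (by rw [cubeSeqM_Om_zero]; exact Finset.mem_univ _)
      · exact hy' (by rw [cubeSeqM_Om_pos x₀ hk ρ S M hM (by omega) (by omega)]; exact mem_cubeFinM_of_dist x₀ k ρ S M j hle)
    have h4 : (radM P.L M ρ S (k - j) : ℝ) = (P.L : ℝ) * (radM P.L M ρ S (k - (j + 1)) : ℝ) + ((P.L : ℝ) * M - 1) + (S : ℝ) := by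
      rw [hkj, radM_succ]
      have hLM : 1 ≤ P.L * M := Nat.one_le_iff_ne_zero.mpr (Nat.mul_ne_zero P.L_pos.ne' (by omega))
      have hsub : ((P.L * M - 1 : ℕ) : ℝ) = (P.L : ℝ) * M - 1 := by rw [Nat.cast_sub hLM, Nat.cast_mul, Nat.cast_one]
      push_cast
      rw [hsub]
    have htri := distSite_triangle (Mk P j) (iterBlockOf j x₀) y y'
    rw [distSite_comm (Mk P j) (iterBlockOf j x₀) y] at htri
    rw [distSite_comm (Mk P j) y' (iterBlockOf j x₀)] at h3
    -- integrality
    have hint : ((radM P.L M ρ S (k - j) : ℕ) : ℝ) + 1 ≤ distSite (Mk P j) (iterBlockOf j x₀) y' := by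
      unfold distSite at h3 ⊢
      have := (Nat.cast_lt (α := ℝ)).1 h3
      exact_mod_cast this
    nlinarith [hL0]
  · exfalso
    have : (cubeSeqM x₀ k hk ρ S M hM).Om (j + 1) = ∅ := (cubeSeqM x₀ k hk ρ S M hM).Om_eq_empty (by simp; omega)
    simp [this] at hy

/-- **`□_j` AS SETS OF FINE SITES** (incl. `□₀` = the saturated fine cube of radius `radM k`; `∅` beyond `k`). [cite: Balaban1985Variational, (144) p.300] -/
def cubeSetM (x₀ : Site P 0) (k ρ S M : ℕ) : ℕ → Set (Site P 0) :=
  fun j => if j ≤ k then {x | iterBlockOf j x ∈ cubeFinM x₀ k ρ S M j} else ∅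

/-- the two readings agree at the positive levels. [cite: Balaban1984PropagatorsII, (2.1) p.224] -/
theorem inOm_cubeSeqM_iff {x₀ : Site P 0} {k : ℕ} (hk : k ≤ P.m + P.K) {ρ S M : ℕ} (hM : 1 ≤ M) {j : ℕ} (hj : 1 ≤ j) (hjk : j ≤ k) (x : Site P 0) :
    (cubeSeqM x₀ k hk ρ S M hM).InOm j x ↔ x ∈ cubeSetM x₀ k ρ S M j := by
  unfold Domains.InOm
  rw [cubeSeqM_Om_pos x₀ hk ρ S M hM hj hjk]
  simp [cubeSetM, hjk]

section T3

open T3ContinuumYM3Torus (T3Family)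

/-- **THE ALIGNED CUBE SEQUENCE AT THE d = 3 CARRIER** (`k = K − n`). [cite: Balaban1985Variational, (144) p.300] -/
def cubeSeqMT3 (F : T3Family) (n K : ℕ) (x₀ : Site (F.P K) 0) (ρ S M : ℕ) (hM : 1 ≤ M) : Domains (F.P K) :=
  cubeSeqM x₀ (K - n) (FlatMinimizerH.le_T3 F n K) ρ S M hM

/-- its top level is `K − n`. [cite: Balaban1985Variational, (144) p.300] -/
@[simp] theorem cubeSeqMT3_k (F : T3Family) (n K : ℕ) (x₀ : Site (F.P K) 0) (ρ S M : ℕ) (hM : 1 ≤ M) : (cubeSeqMT3 F n K x₀ ρ S M hM).k = K - n := rfl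

end T3

end Summit.QuantumFields.YangMills.Theorems.FlatCubeSequenceAligned

end
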